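import Literature.NumberTheory.ModularForms.PoincareSeriesWeightTwoHeckeLimit
import Mathlib.Analysis.SpecialFunctions.JapaneseBracket
import Mathlib.MeasureTheory.Measure.Haar.NormedSpace
import HarnessLib

/-!
# Decay of the cells of the weight-2 Hecke–Poincaré series in the Kloosterman modulus,
# uniformly down to the real line

Topic `Literature/NumberTheory/ModularForms` (namespace `Literature.NumberTheory.ModularForms.PoincareWeightTwo`,
continuing `PoincareSeriesWeightTwoHecke.lean` (definitions), `…ModeIntegral.lean` (the cell integral
`I_s(A,B;y) = modeIntegral s A B y`) and `…HeckeLimit.lean` (`cellTerm`, `cellMajorant`)). THEOREMS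
ONLY; no definition, no named fact.

The point of this file is the estimate that the `L²` (Gram/unfolding) treatment of Hecke's limit
`s → 0⁺` needs near `y → 0` (Iwaniec–Kowalski §14.2 with §3.2; the `y → 0` end of the strip
`Γ_∞\ℍ` is where the other cusps of `Γ₀(N)` live). The crude bound
`‖I_s(A,B;y)‖ ≤ (2π/y)(y/2)^{−2s}e^{−π|B|y}` of `…ModeIntegral.lean` forgets the factor
`|e(−A/(t+iy))| = e^{−2πAy/(t²+y²)}`; keeping it and using `e^{−x} ≤ 2x^{−k}` with `k = s + 1/8`:

* `norm_modeIntegral_le_decay` — `‖I_s(A,B;y)‖ ≤ L · A^{−(s+1/8)} · y^{−(s+7/8)}` for `0 ≤ s ≤ 1`,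
  `A > 0`, `y > 0`, all real `B`, with ONE absolute constant `L`;
* `norm_cellTerm_le_decay` — with `A = m/c²`, `c = Nr`, and Weil's bound
  `|S(m,n;c)| ≤ (m,n,c)^{1/2} c^{1/2} τ(c)` (tree theorem `weil_kloosterman_bound_holds`): the powers
  `c^{−2−2s} · c^{1/2} · c^{2s+1/4}` collapse to `c^{−5/4}`, UNIFORMLY in `s`:
  `‖cellTerm N m s n y r‖ ≤ L √m τ(Nr) (Nr)^{−5/4} y^{−(s+7/8)}`;
* `exists_norm_tsum_cellTerm_le` — hence, by the divisor bound `τ(c) ≤ C c^{1/8}`,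
  `‖Σ_r cellTerm N m s n y r‖ ≤ C(N,m) · y^{−(s+7/8)}` for all `0 ≤ s ≤ 1`, `n ∈ ℤ`, `y > 0`.

So the non-diagonal part of every Fourier mode of `P_m(·+iy,s)` is `O(y^{−7/8−s})`, and
`y^{s+s'} · (mode at s')` is `O(y^{s−7/8})`, integrable at `y = 0` uniformly in `s, s' ∈ [0,1]` — the
domination for the Gram pairings `⟨yˢP_m(·,s), y^{s'}P_m(·,s')⟩` (stub T4 `HeckeL2` of the I1 skeleton
`Summits/Parity/GeneralizedHardyLittlewood/Cruxes/PeterssonBoundPrinted/Lines/poincare_hecke.lean`,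
Kowalski–Michel 2000 Petersson formula, stmt-Parity-20404).

## References

* [IwaniecKowalski2004] H. Iwaniec, E. Kowalski, *Analytic Number Theory*, AMS Colloq. Publ. 53,
  §14.2 (proof of Lemma 14.2), §3.2 (Hecke's trick).
* [Iwaniec2002] H. Iwaniec, *Spectral Methods of Automorphic Forms*, §2.5 (2.25) (Weil's bound), §3.2.
-/

noncomputable section

open scoped Real Topology
open Complex MeasureTheory Filter Set
open Literature.NumberTheory.LFunctions (kloostermanSum weil_kloosterman_bound_holds)

namespace Literature.NumberTheory.ModularForms.PoincareWeightTwo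

/-! ## An elementary exponential bound -/

/-- `e^{−x} ≤ 2 x^{−k}` for `x > 0`, `0 ≤ k ≤ 2` (`x²/2 ≤ eˣ`). [folklore] -/
private theorem exp_neg_le_two_mul_rpow_neg {x k : ℝ} (hx : 0 < x) (hk0 : 0 ≤ k) (hk2 : k ≤ 2) :
    Real.exp (-x) ≤ 2 * x ^ (-k) := by
  rcases le_or_gt 1 x with h1 | h1
  · have hq := Real.quadratic_le_exp_of_nonneg hx.le
    have hx2 : x ^ 2 ≤ 2 * Real.exp x := by nlinarith [hq]
    have h2 : Real.exp (-x) ≤ 2 * x ^ (-(2 : ℝ)) := by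
      rw [Real.exp_neg, Real.rpow_neg hx.le, Real.rpow_two, ← div_eq_mul_inv, inv_eq_one_div,
        div_le_div_iff₀ (Real.exp_pos x) (by positivity)]
      linarith
    calc Real.exp (-x) ≤ 2 * x ^ (-(2 : ℝ)) := h2
      _ ≤ 2 * x ^ (-k) := by gcongr
  · have h3 : 1 ≤ x ^ (-k) := Real.one_le_rpow_of_pos_of_le_one_of_nonpos hx h1.le (by linarith)
    have h4 : Real.exp (-x) ≤ 1 := Real.exp_le_one_iff.mpr (by linarith)
    linarith

/-! ## The integrand with the `A`-decay kept -/

/-- The exact size of the integrand of `modeIntegral`: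
`‖(t+iy)⁻² |t+iy|^{−2s} e(−A/(t+iy) − Bt)‖ = (t²+y²)⁻¹ (t²+y²)^{−s} e^{−2πAy/(t²+y²)}`.
[cite: IwaniecKowalski2004, §14.2 (proof of Lemma 14.2)] -/
theorem norm_modeIntegrand_eq (s A B : ℝ) {y : ℝ} (hy : 0 < y) (t : ℝ) :
    ‖(((t : ℂ) + y * I) ^ 2)⁻¹ * ((‖(t : ℂ) + y * I‖ ^ (-(2 * s)) : ℝ) : ℂ) *
      cexp (2 * π * I * (-(A : ℂ) / ((t : ℂ) + y * I) - B * t))‖ =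
      (t ^ 2 + y ^ 2)⁻¹ * (t ^ 2 + y ^ 2) ^ (-s) * Real.exp (-(2 * π * A * y / (t ^ 2 + y ^ 2))) := by
  have hpos : 0 < t ^ 2 + y ^ 2 := by positivity
  have hnormSq : Complex.normSq ((t : ℂ) + y * I) = t ^ 2 + y ^ 2 := by
    rw [Complex.normSq_add_mul_I]
  have hnorm2 : ‖(t : ℂ) + y * I‖ ^ 2 = t ^ 2 + y ^ 2 := by
    rw [Complex.sq_norm, hnormSq]
  have h1 : ‖(((t : ℂ) + y * I) ^ 2)⁻¹‖ = (t ^ 2 + y ^ 2)⁻¹ := by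
    rw [norm_inv, norm_pow, hnorm2]
  have h2 : ‖(((‖(t : ℂ) + y * I‖ ^ (-(2 * s)) : ℝ) : ℂ))‖ = (t ^ 2 + y ^ 2) ^ (-s) := by
    rw [Complex.norm_real, Real.norm_of_nonneg (Real.rpow_nonneg (norm_nonneg _) _),
      Complex.norm_add_mul_I, Real.sqrt_eq_rpow, ← Real.rpow_mul hpos.le]
    congr 1
    ring
  have h3 : ‖cexp (2 * π * I * (-(A : ℂ) / ((t : ℂ) + y * I) - B * t))‖ =
      Real.exp (-(2 * π * A * y / (t ^ 2 + y ^ 2))) := by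
    rw [Complex.norm_exp]
    congr 1
    have him : (-(A : ℂ) / ((t : ℂ) + y * I)).im = A * y / (t ^ 2 + y ^ 2) := by
      rw [Complex.div_im, hnormSq]
      simp
      ring
    have hre : (2 * π * I * (-(A : ℂ) / ((t : ℂ) + y * I) - B * t)).re =
        -(2 * π) * (-(A : ℂ) / ((t : ℂ) + y * I) - B * t).im := by
      simp [Complex.mul_re]
    rw [hre, Complex.sub_im, him]
    simp
    ring
  rw [norm_mul, norm_mul, h1, h2, h3]

/-- **The integrand dominated with the `A`-decay used**: for `0 ≤ s ≤ 1`, `A > 0`, `y > 0`,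
`‖(t+iy)⁻² |t+iy|^{−2s} e(−A/(t+iy) − Bt)‖ ≤ 2 (2πAy)^{−(s+1/8)} (t²+y²)^{−7/8}`
(`e^{−x} ≤ 2x^{−k}`, `k = s + 1/8`). [cite: IwaniecKowalski2004, §14.2 (proof of Lemma 14.2)] -/
theorem norm_modeIntegrand_le_decay {s A y : ℝ} (hs0 : 0 ≤ s) (hs1 : s ≤ 1) (hA : 0 < A)
    (hy : 0 < y) (B t : ℝ) :
    ‖(((t : ℂ) + y * I) ^ 2)⁻¹ * ((‖(t : ℂ) + y * I‖ ^ (-(2 * s)) : ℝ) : ℂ) *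
      cexp (2 * π * I * (-(A : ℂ) / ((t : ℂ) + y * I) - B * t))‖ ≤
      2 * (2 * π * A * y) ^ (-(s + 1 / 8)) * (t ^ 2 + y ^ 2) ^ (-(7 / 8 : ℝ)) := by
  rw [norm_modeIntegrand_eq s A B hy t]
  have hb : 0 < t ^ 2 + y ^ 2 := by positivity
  have ha : 0 < 2 * π * A * y := by positivity
  set b : ℝ := t ^ 2 + y ^ 2 with hb_def
  set k : ℝ := s + 1 / 8 with hk_def
  have hx : 0 < 2 * π * A * y / b := div_pos ha hb
  have hexp := exp_neg_le_two_mul_rpow_neg (k := k) hx (by positivity) (by rw [hk_def]; linarith)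
  -- `(a/b)^{-k} = a^{-k} b^{k}`
  have hsplit : (2 * π * A * y / b) ^ (-k) = (2 * π * A * y) ^ (-k) * b ^ k := by
    rw [Real.div_rpow ha.le hb.le, Real.rpow_neg hb.le, div_inv_eq_mul]
  -- `b⁻¹ b^{-s} b^{k} = b^{-7/8}`
  have hpow : b⁻¹ * b ^ (-s) * b ^ k = b ^ (-(7 / 8 : ℝ)) := by
    rw [← Real.rpow_neg_one, ← Real.rpow_add hb, ← Real.rpow_add hb]
    congr 1
    rw [hk_def]; ring
  calc b⁻¹ * b ^ (-s) * Real.exp (-(2 * π * A * y / b))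
      ≤ b⁻¹ * b ^ (-s) * (2 * (2 * π * A * y / b) ^ (-k)) := by
        gcongr
    _ = 2 * (2 * π * A * y) ^ (-k) * (b⁻¹ * b ^ (-s) * b ^ k) := by rw [hsplit]; ring
    _ = 2 * (2 * π * A * y) ^ (-k) * b ^ (-(7 / 8 : ℝ)) := by rw [hpow]

/-! ## The scaled profile `(t²+y²)^{−7/8}` and its integral -/

/-- The profile `(1+u²)^{−7/8}` is integrable on `ℝ` (exponent `7/4 > 1 = dim`).
[folklore] -/
private theorem integrable_one_add_sq_rpow :
    Integrable fun u : ℝ ↦ ((1 : ℝ) + ‖u‖ ^ 2) ^ (-(7 / 4 : ℝ) / 2) :=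
  integrable_rpow_neg_one_add_norm_sq (by simp; norm_num)

/-- Scaling: `(t²+y²)^{−7/8} = y^{−7/4} (1 + (y⁻¹t)²)^{−7/8}` for `y > 0`. [folklore] -/
private theorem sq_add_sq_rpow_eq_scaled {y : ℝ} (hy : 0 < y) (t : ℝ) :
    (t ^ 2 + y ^ 2) ^ (-(7 / 8 : ℝ)) =
      y ^ (-(7 / 4 : ℝ)) * ((1 : ℝ) + ‖y⁻¹ * t‖ ^ 2) ^ (-(7 / 4 : ℝ) / 2) := by
  have hy2 : 0 < y ^ 2 := by positivity
  have hrat : (1 : ℝ) + ‖y⁻¹ * t‖ ^ 2 = (t ^ 2 + y ^ 2) / y ^ 2 := by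
    rw [Real.norm_eq_abs, sq_abs]
    field_simp
    ring
  rw [hrat, show (-(7 / 4 : ℝ) / 2) = -(7 / 8 : ℝ) by norm_num,
    Real.div_rpow (by positivity) hy2.le, show y ^ 2 = y ^ (2 : ℝ) by norm_cast,
    ← Real.rpow_mul hy.le]
  have hne : (y ^ ((2 : ℝ) * -(7 / 8 : ℝ))) ≠ 0 := (Real.rpow_pos_of_pos hy _).ne'
  rw [mul_div_assoc', eq_div_iff hne, mul_comm]
  rw [show (2 : ℝ) * -(7 / 8 : ℝ) = -(7 / 4 : ℝ) by norm_num]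

/-- `∫_ℝ (t²+y²)^{−7/8} dt = y^{−3/4} · ∫_ℝ (1+u²)^{−7/8} du` (`y > 0`). [folklore] -/
private theorem integral_sq_add_sq_rpow {y : ℝ} (hy : 0 < y) :
    ∫ t : ℝ, (t ^ 2 + y ^ 2) ^ (-(7 / 8 : ℝ)) =
      y ^ (-(3 / 4 : ℝ)) * ∫ u : ℝ, ((1 : ℝ) + ‖u‖ ^ 2) ^ (-(7 / 4 : ℝ) / 2) := by
  simp_rw [sq_add_sq_rpow_eq_scaled hy]
  rw [integral_const_mul,
    Measure.integral_comp_inv_mul_left (fun u : ℝ ↦ ((1 : ℝ) + ‖u‖ ^ 2) ^ (-(7 / 4 : ℝ) / 2)) y,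
    abs_of_pos hy, smul_eq_mul, ← mul_assoc]
  congr 1
  rw [show y = y ^ (1 : ℝ) from (Real.rpow_one y).symm]
  rw [← Real.rpow_mul hy.le, ← Real.rpow_add hy]
  norm_num

/-- The scaled profile is integrable. [folklore] -/
private theorem integrable_sq_add_sq_rpow {y : ℝ} (hy : 0 < y) :
    Integrable fun t : ℝ ↦ (t ^ 2 + y ^ 2) ^ (-(7 / 8 : ℝ)) := by
  simp_rw [sq_add_sq_rpow_eq_scaled hy]
  exact (integrable_one_add_sq_rpow.comp_mul_left' (inv_ne_zero hy.ne')).const_mul _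

/-! ## The cell integral -/

/-- **Decay of the cell integral in `A`, uniformly down to `y = 0`:** there is an absolute
constant `L ≥ 0` with `‖I_s(A, B; y)‖ ≤ L · A^{−(s+1/8)} · y^{−(s+7/8)}` for all `0 ≤ s ≤ 1`,
`A > 0`, `y > 0` and real `B` (`L = 2∫(1+u²)^{−7/8}du`; the factor `(2π)^{−(s+1/8)} ≤ 1` is
discarded). [cite: IwaniecKowalski2004, §14.2 (proof of Lemma 14.2) with §3.2] -/
theorem norm_modeIntegral_le_decay :
    ∃ L : ℝ, 0 ≤ L ∧ ∀ (s A B y : ℝ), 0 ≤ s → s ≤ 1 → 0 < A → 0 < y →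
      ‖modeIntegral s A B y‖ ≤ L * A ^ (-(s + 1 / 8)) * y ^ (-(s + 7 / 8)) := by
  set L₀ : ℝ := ∫ u : ℝ, ((1 : ℝ) + ‖u‖ ^ 2) ^ (-(7 / 4 : ℝ) / 2) with hL₀
  have hL₀ : 0 ≤ L₀ := integral_nonneg fun u ↦ Real.rpow_nonneg (by positivity) _
  refine ⟨2 * L₀, by positivity, fun s A B y hs0 hs1 hA hy ↦ ?_⟩
  have hk : 0 < s + 1 / 8 := by linarith
  -- integrate the pointwise bound
  have hint : ‖modeIntegral s A B y‖ ≤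
      ∫ t : ℝ, 2 * (2 * π * A * y) ^ (-(s + 1 / 8)) * (t ^ 2 + y ^ 2) ^ (-(7 / 8 : ℝ)) := by
    unfold modeIntegral
    refine norm_integral_le_of_norm_le ((integrable_sq_add_sq_rpow hy).const_mul _) ?_
    exact Eventually.of_forall fun t ↦ norm_modeIntegrand_le_decay hs0 hs1 hA hy B t
  rw [integral_const_mul, integral_sq_add_sq_rpow hy] at hint
  refine hint.trans ?_
  -- bookkeeping of the powers
  have h2π : (2 * π * A * y) ^ (-(s + 1 / 8)) =
      (2 * π) ^ (-(s + 1 / 8)) * A ^ (-(s + 1 / 8)) * y ^ (-(s + 1 / 8)) := by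
    rw [Real.mul_rpow (by positivity) hy.le, Real.mul_rpow (by positivity) hA.le]
  have hyy : y ^ (-(s + 1 / 8)) * y ^ (-(3 / 4 : ℝ)) = y ^ (-(s + 7 / 8)) := by
    rw [← Real.rpow_add hy]; congr 1; ring
  rw [h2π]
  have h1 : (2 * π : ℝ) ^ (-(s + 1 / 8)) ≤ 1 :=
    Real.rpow_le_one_of_one_le_of_nonpos (by linarith [Real.pi_gt_three]) (by linarith)
  have hM : 0 ≤ 2 * L₀ * A ^ (-(s + 1 / 8)) * y ^ (-(s + 7 / 8)) := by positivity
  calc 2 * ((2 * π) ^ (-(s + 1 / 8)) * A ^ (-(s + 1 / 8)) * y ^ (-(s + 1 / 8))) * (y ^ (-(3 / 4 : ℝ)) * L₀)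
      = (2 * π) ^ (-(s + 1 / 8)) * (2 * L₀ * A ^ (-(s + 1 / 8)) * y ^ (-(s + 7 / 8))) := by
        rw [← hyy]; ring
    _ ≤ 1 * (2 * L₀ * A ^ (-(s + 1 / 8)) * y ^ (-(s + 7 / 8))) := by gcongr
    _ = 2 * L₀ * A ^ (-(s + 1 / 8)) * y ^ (-(s + 7 / 8)) := one_mul _

/-! ## The cells -/

/-- The arithmetic part of a cell with Hecke's factor KEPT (unlike `norm_cell_arith_le`, which
discards `c^{−2s} ≤ 1`): `‖(Nr)⁻² (Nr)^{−2s} S(m,n;Nr)‖ ≤ (Nr)⁻² (Nr)^{−2s} · √m √(Nr) τ(Nr)`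
(Weil's bound, `(m,n,c) ≤ m`). [cite: Iwaniec2002, §2.5 (2.25)] -/
theorem norm_cell_arith_le_rpow {N : ℕ} [NeZero N] {m : ℕ} (hm : 1 ≤ m) (s : ℝ) (n : ℤ)
    {r : ℕ} (hr : r ≠ 0) :
    haveI : NeZero (N * r) := ⟨mul_ne_zero (NeZero.ne N) hr⟩
    ‖(((N * r : ℕ) : ℂ) ^ 2)⁻¹ * ((((N * r : ℕ) : ℝ) ^ (-(2 * s)) : ℝ) : ℂ) *
        kloostermanSum (N * r) ((m : ℤ) : ZMod (N * r)) ((n : ℤ) : ZMod (N * r))‖ ≤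
      (((N * r : ℕ) : ℝ) ^ 2)⁻¹ * ((N * r : ℕ) : ℝ) ^ (-(2 * s)) *
        (Real.sqrt m * Real.sqrt ((N * r : ℕ) : ℝ) * ((N * r : ℕ).divisors.card : ℝ)) := by
  haveI : NeZero (N * r) := ⟨mul_ne_zero (NeZero.ne N) hr⟩
  set c : ℕ := N * r with hc
  have hc0 : c ≠ 0 := mul_ne_zero (NeZero.ne N) hr
  have hW := weil_kloosterman_bound_holds c (m : ℤ) n
  have hgcd : (Nat.gcd (Nat.gcd (m : ℤ).natAbs n.natAbs) c : ℝ) ≤ m := by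
    have h1 : Nat.gcd (Nat.gcd (m : ℤ).natAbs n.natAbs) c ∣ m := by
      rw [Int.natAbs_natCast]
      exact Nat.dvd_trans (Nat.gcd_dvd_left _ _) (Nat.gcd_dvd_left _ _)
    exact_mod_cast Nat.le_of_dvd (by omega) h1
  have hS : ‖kloostermanSum c ((m : ℤ) : ZMod c) (n : ZMod c)‖ ≤
      Real.sqrt m * Real.sqrt c * (c.divisors.card : ℝ) := by
    refine hW.trans ?_
    gcongr
  have h1 : ‖(((c : ℕ) : ℂ) ^ 2)⁻¹‖ = (((c : ℕ) : ℝ) ^ 2)⁻¹ := by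
    rw [norm_inv, norm_pow, Complex.norm_natCast]
  have h2 : ‖((((c : ℕ) : ℝ) ^ (-(2 * s)) : ℝ) : ℂ)‖ = ((c : ℕ) : ℝ) ^ (-(2 * s)) := by
    rw [Complex.norm_real, Real.norm_of_nonneg (Real.rpow_nonneg (by positivity) _)]
  rw [norm_mul, norm_mul, h1, h2]
  gcongr

/-- The exponent bookkeeping of a cell: `c⁻² c^{−2s} √c (m/c²)^{−(s+1/8)} = m^{−(s+1/8)} c^{−5/4}`
(`c, m > 0`). [folklore] -/
private theorem cell_powers {c m : ℝ} (hc : 0 < c) (hm : 0 < m) (s : ℝ) :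
    (c ^ 2)⁻¹ * c ^ (-(2 * s)) * Real.sqrt c * (m / c ^ 2) ^ (-(s + 1 / 8)) =
      m ^ (-(s + 1 / 8)) * c ^ (-(5 / 4 : ℝ)) := by
  have e1 : (c ^ 2)⁻¹ = c ^ (-(2 : ℝ)) := by rw [Real.rpow_neg hc.le, Real.rpow_two]
  have e2 : Real.sqrt c = c ^ (1 / 2 : ℝ) := Real.sqrt_eq_rpow c
  have e3 : (m / c ^ 2) ^ (-(s + 1 / 8)) = m ^ (-(s + 1 / 8)) * c ^ (2 * (s + 1 / 8)) := by
    rw [Real.div_rpow hm.le (by positivity), div_eq_mul_inv, ← Real.rpow_neg (by positivity),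
      neg_neg, ← Real.rpow_two, ← Real.rpow_mul hc.le]
  rw [e1, e2, e3]
  have h : c ^ (-(2 : ℝ)) * c ^ (-(2 * s)) * c ^ (1 / 2 : ℝ) * c ^ (2 * (s + 1 / 8)) =
      c ^ (-(5 / 4 : ℝ)) := by
    rw [← Real.rpow_add hc, ← Real.rpow_add hc, ← Real.rpow_add hc]; congr 1; ring
  calc c ^ (-(2 : ℝ)) * c ^ (-(2 * s)) * c ^ (1 / 2 : ℝ) * (m ^ (-(s + 1 / 8)) * c ^ (2 * (s + 1 / 8)))
      = m ^ (-(s + 1 / 8)) * (c ^ (-(2 : ℝ)) * c ^ (-(2 * s)) * c ^ (1 / 2 : ℝ) * c ^ (2 * (s + 1 / 8))) := by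
        ring
    _ = m ^ (-(s + 1 / 8)) * c ^ (-(5 / 4 : ℝ)) := by rw [h]

/-- **Decay of the cells in the modulus, uniformly in `0 ≤ s ≤ 1` and down to `y = 0`:** with the
absolute constant `L` of `norm_modeIntegral_le_decay`, for `m ≥ 1`, `n ∈ ℤ`, `y > 0`,
`‖cellTerm N m s n y r‖ ≤ L √m τ(Nr) (Nr)^{−5/4} y^{−(s+7/8)}` — the factors
`(Nr)^{−2−2s} · √(Nr) · (m/(Nr)²)^{−(s+1/8)}` collapse to `m^{−(s+1/8)}(Nr)^{−5/4}` and
`m^{−(s+1/8)} ≤ 1`. [cite: IwaniecKowalski2004, §14.2 (proof of Lemma 14.2) with §3.2] -/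
theorem norm_cellTerm_le_decay :
    ∃ L : ℝ, 0 ≤ L ∧ ∀ (N : ℕ) [NeZero N] (m : ℕ), 1 ≤ m → ∀ (s : ℝ), 0 ≤ s → s ≤ 1 →
      ∀ (n : ℤ) (y : ℝ), 0 < y → ∀ r : ℕ,
        ‖cellTerm N m s n y r‖ ≤
          L * Real.sqrt m * ((N * r : ℕ).divisors.card : ℝ) * ((N * r : ℕ) : ℝ) ^ (-(5 / 4 : ℝ)) *
            y ^ (-(s + 7 / 8)) := by
  obtain ⟨L, hL0, hL⟩ := norm_modeIntegral_le_decay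
  refine ⟨L, hL0, fun N _ m hm s hs0 hs1 n y hy r ↦ ?_⟩
  rcases eq_or_ne r 0 with rfl | hr
  · simp
  haveI : NeZero (N * r) := ⟨mul_ne_zero (NeZero.ne N) hr⟩
  have hc : (0 : ℝ) < ((N * r : ℕ) : ℝ) := by
    exact_mod_cast Nat.pos_of_ne_zero (mul_ne_zero (NeZero.ne N) hr)
  have hm0 : (0 : ℝ) < m := by exact_mod_cast hm
  have hA : 0 < (m : ℝ) / ((N * r : ℕ) : ℝ) ^ 2 := by positivity
  set c : ℝ := ((N * r : ℕ) : ℝ) with hcdef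
  set τ : ℝ := ((N * r : ℕ).divisors.card : ℝ) with hτdef
  rw [cellTerm_of_ne_zero m s n y hr, norm_mul]
  have hI := hL s ((m : ℝ) / c ^ 2) n y hs0 hs1 hA hy
  have hmpow : (m : ℝ) ^ (-(s + 1 / 8)) ≤ 1 :=
    Real.rpow_le_one_of_one_le_of_nonpos (by exact_mod_cast hm) (by linarith)
  calc ‖(((N * r : ℕ) : ℂ) ^ 2)⁻¹ * ((c ^ (-(2 * s)) : ℝ) : ℂ) *
          kloostermanSum (N * r) ((m : ℤ) : ZMod (N * r)) ((n : ℤ) : ZMod (N * r))‖ *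
        ‖modeIntegral s ((m : ℝ) / c ^ 2) n y‖
      ≤ ((c ^ 2)⁻¹ * c ^ (-(2 * s)) * (Real.sqrt m * Real.sqrt c * τ)) *
          (L * ((m : ℝ) / c ^ 2) ^ (-(s + 1 / 8)) * y ^ (-(s + 7 / 8))) :=
        mul_le_mul (norm_cell_arith_le_rpow hm s n hr) hI (norm_nonneg _) (by positivity)
    _ = L * Real.sqrt m * τ * y ^ (-(s + 7 / 8)) *
          ((c ^ 2)⁻¹ * c ^ (-(2 * s)) * Real.sqrt c * ((m : ℝ) / c ^ 2) ^ (-(s + 1 / 8))) := by ring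
    _ = L * Real.sqrt m * τ * y ^ (-(s + 7 / 8)) * ((m : ℝ) ^ (-(s + 1 / 8)) * c ^ (-(5 / 4 : ℝ))) := by
        rw [cell_powers hc hm0 s]
    _ ≤ L * Real.sqrt m * τ * y ^ (-(s + 7 / 8)) * (1 * c ^ (-(5 / 4 : ℝ))) := by gcongr
    _ = L * Real.sqrt m * τ * c ^ (-(5 / 4 : ℝ)) * y ^ (-(s + 7 / 8)) := by ring

/-- **The non-diagonal part of every Fourier mode is `O(y^{−7/8−s})`, uniformly**: for `N, m ≥ 1`
there is `C = C(N,m) ≥ 0` such that for all `0 ≤ s ≤ 1`, `n ∈ ℤ`, `y > 0` the `r`-series of cells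
converges absolutely and `‖Σ_r cellTerm N m s n y r‖ ≤ C · y^{−(s+7/8)}` (divisor bound
`τ(c) ≤ C₈ c^{1/8}`, so the cells are `≪ (Nr)^{−9/8}`). [cite: IwaniecKowalski2004, §14.2 (proof of Lemma 14.2) with §3.2] -/
theorem exists_norm_tsum_cellTerm_le (N : ℕ) [NeZero N] {m : ℕ} (hm : 1 ≤ m) :
    ∃ C : ℝ, 0 ≤ C ∧ ∀ (s : ℝ), 0 ≤ s → s ≤ 1 → ∀ (n : ℤ) (y : ℝ), 0 < y →
      Summable (fun r : ℕ ↦ ‖cellTerm N m s n y r‖) ∧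
      ‖∑' r : ℕ, cellTerm N m s n y r‖ ≤ C * y ^ (-(s + 7 / 8)) := by
  obtain ⟨L, hL0, hL⟩ := norm_cellTerm_le_decay
  obtain ⟨C₈, hC₈1, hC₈⟩ :=
    Literature.NumberTheory.Sieve.exists_card_divisors_le_mul_rpow' (by norm_num : (0 : ℝ) < 1 / 8)
  have hN : (0 : ℝ) < N := by exact_mod_cast Nat.pos_of_ne_zero (NeZero.ne N)
  -- the majorant `M r = L √m C₈ (Nr)^{−9/8}`
  set M : ℕ → ℝ := fun r ↦ L * Real.sqrt m * C₈ * ((N : ℝ) ^ (-(9 / 8 : ℝ)) * (r : ℝ) ^ (-(9 / 8 : ℝ)))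
    with hM
  have hMsum : Summable M := by
    simp only [hM]
    exact ((Real.summable_nat_rpow.mpr (by norm_num)).mul_left _).mul_left _
  have hM0 : ∀ r, 0 ≤ M r := fun r ↦ by simp only [hM]; positivity
  refine ⟨∑' r, M r, tsum_nonneg hM0, fun s hs0 hs1 n y hy ↦ ?_⟩
  have hys : 0 < y ^ (-(s + 7 / 8)) := Real.rpow_pos_of_pos hy _
  -- termwise: `‖cellTerm r‖ ≤ M r · y^{−(s+7/8)}`
  have hterm : ∀ r : ℕ, ‖cellTerm N m s n y r‖ ≤ M r * y ^ (-(s + 7 / 8)) := by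
    intro r
    rcases eq_or_ne r 0 with rfl | hr
    · simp [hM]
    have hc : (0 : ℝ) < ((N * r : ℕ) : ℝ) := by
      exact_mod_cast Nat.pos_of_ne_zero (mul_ne_zero (NeZero.ne N) hr)
    refine (hL N m hm s hs0 hs1 n y hy r).trans ?_
    have hτ := hC₈ (N * r)
    have hpow : ((N * r : ℕ) : ℝ) ^ (1 / 8 : ℝ) * ((N * r : ℕ) : ℝ) ^ (-(5 / 4 : ℝ)) =
        (N : ℝ) ^ (-(9 / 8 : ℝ)) * (r : ℝ) ^ (-(9 / 8 : ℝ)) := by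
      rw [← Real.rpow_add hc, ← Real.mul_rpow hN.le (by positivity)]
      push_cast
      norm_num
    calc L * Real.sqrt m * ((N * r : ℕ).divisors.card : ℝ) * ((N * r : ℕ) : ℝ) ^ (-(5 / 4 : ℝ)) *
          y ^ (-(s + 7 / 8))
        ≤ L * Real.sqrt m * (C₈ * ((N * r : ℕ) : ℝ) ^ (1 / 8 : ℝ)) * ((N * r : ℕ) : ℝ) ^ (-(5 / 4 : ℝ)) *
          y ^ (-(s + 7 / 8)) := by gcongr
      _ = L * Real.sqrt m * C₈ * (((N * r : ℕ) : ℝ) ^ (1 / 8 : ℝ) * ((N * r : ℕ) : ℝ) ^ (-(5 / 4 : ℝ))) *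
          y ^ (-(s + 7 / 8)) := by ring
      _ = M r * y ^ (-(s + 7 / 8)) := by rw [hpow]
  have hsum : Summable (fun r : ℕ ↦ ‖cellTerm N m s n y r‖) :=
    (hMsum.mul_right _).of_nonneg_of_le (fun _ ↦ norm_nonneg _) hterm
  refine ⟨hsum, ?_⟩
  calc ‖∑' r : ℕ, cellTerm N m s n y r‖ ≤ ∑' r : ℕ, ‖cellTerm N m s n y r‖ := norm_tsum_le_tsum_norm hsum
    _ ≤ ∑' r : ℕ, M r * y ^ (-(s + 7 / 8)) := hsum.tsum_le_tsum hterm (hMsum.mul_right _)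
    _ = (∑' r : ℕ, M r) * y ^ (-(s + 7 / 8)) := tsum_mul_right

end Literature.NumberTheory.ModularForms.PoincareWeightTwo

end
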